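import Literature.Topology.LocallyConstantCompactFamily      -- ★ p844033 (this seat): tube lemma for locally constant functions, parametric-integral local constancy
import Mathlib.Topology.Algebra.Group.Basic
import HarnessLib

/-!
# Shell averages `x ↦ ∫_S φ(k⁻¹·(r⁻¹ x r)·k) dν(k)` of a locally constant `φ` are locally constant in `x`, and so are finite WINDOW SUMS of them
# (road «R1LL-WILD» (Ψ3): «the window sum is eventually constant», in the shell-unfolding currency)

Topic `NumberTheory/Automorphic`; namespace `Literature.NumberTheory.Automorphic`.  THEOREMS ONLY (no definition, no instance, no notation, no named fact,
no `sorry`); generic topological group, Mathlib + ★ `Literature.Topology.LocallyConstantCompactFamily` only.  Cell `pub/hodgecm-mathlib` (D-0151), crux H413 =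
`stmt-HodgeConjecture-24833`; architect A-p16 (g28) RULINGS A-37 (deal (Ψ3) → B-p04 (g35)), A-43∕A-44 (consumer = (W′-B6) F0P3-p01 (g14), binder `hW` of p04 (g14)'s
(γ) layer `rankOneUnstable_core_of_shellWindow`).  FILE 2a of (Ψ3): the GROUP form of the engine, keyed to the (Ψ1) unfolding head of record ★ p844070
`integral_conj_eq_sum_ncard_shell_smul_onePlace` (B-p14 (g33)), whose shell values are EXACTLY `∫ k in ↑K, f (k⁻¹ * (r⁻¹ * x * r) * k) ∂ν`.

THE POINT [LabesseLanglands1979 §2 p. 9 «window»; Labesse2024 Prop. 0.0.11 ∕ Th. 0.0.12].  After the orbital integral `O(x, f)` is unfolded over the shells of the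
tree, `O(x,f) = Σ_m #shell_m(x) · f̄_m(x)` with the SHELL AVERAGE `f̄_m(x) = ∫_K f(k⁻¹ r_m⁻¹ x r_m k) dν(k)` (`K` compact open, `r_m` the shell representative), the
difference `O(t,f) − O(ẽt,f)` along an elliptic torus is, for deep regular `t`, a sign times `q^{ord β(t)}` times a WINDOW SUM of finitely many shell averages
evaluated at group elements `A_i(t)`, `B_i(t)` that depend CONTINUOUSLY on `t` (once the unit part of `β(t)` has been conjugated into `K`).  Since `f` is locally
constant and `K` is compact, each `t ↦ f̄(A_i(t))` is LOCALLY CONSTANT (tube lemma ★ `Literature.Topology.eventually_forall_apply_eq_of_isLocallyConstant`), hence so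
is the window sum — at singular `t` included.  This file packages exactly that, with the weakest hypotheses the END needs:

* §1 `eventually_forall_apply_conj_eq_of_continuousAt` — `φ` locally constant, `S` compact, `A` continuous AT `x₀` only:
  `∀ᶠ x in 𝓝 x₀, ∀ k ∈ S, φ (k⁻¹ * A x * k) = φ (k⁻¹ * A x₀ * k)`; shell-translated form `…(r⁻¹ * A x * r)…`.
* §2 `eventually_setIntegral_conj_apply_eq_of_continuousAt`, `isLocallyConstant_setIntegral_conj_apply` (+ `_translate` forms): the shell average
  `x ↦ ∫ k in S, φ (k⁻¹ * (r⁻¹ * A x * r) * k) ∂ν` freezes near `x₀` ∕ is locally constant (ANY measure; `S` measurable).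
* §3 WINDOWS: `isLocallyConstant_sum_smul_setIntegral_conj_sub` — `x ↦ ∑_{i ∈ I} a_i • (f̄_{r_i}(A_i x) − f̄_{r_i}(B_i x))` is locally constant for continuous
  families `A_i, B_i` (the `O(t) − O(ẽt)` window), and its `ContinuousAt` version `eventually_sum_smul_setIntegral_conj_sub_eq_of_continuousAt`.
* §4 the fold's binder shape: `forall_imp_eventually_mem_imp_sum_smul_setIntegral_conj_sub_eq` — `∀ s, P s → ∀ᶠ t in 𝓝 s, t ∈ U → W t = W s` for such `W`.

HONEST LABEL: HC_CM is proved only modulo the 2 remaining named inputs (hLiu418, h413) until rung 0 closes; this file is unconditional topology ∕ measure bookkeeping.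

## References
* [LabesseLanglands1979] J.-P. Labesse, R. P. Langlands, *L-indistinguishability for SL(2)*, Canad. J. Math. 31 (1979): §2 pp. 8–9.
* [Labesse2024StabilisationGermesSL2] J.-P. Labesse, *Stabilisation des germes de SL(2)*, arXiv:2411.14820: Prop. 0.0.11, Th. 0.0.12.
* [Bourbaki1995] N. Bourbaki, *General Topology: Chapters 1–4* (1995): Ch. I §10.2 (tube lemma).
-/

set_option autoImplicit false

open Set Filter Topology MeasureTheory

namespace Literature.NumberTheory.Automorphic

section Pointwise

variable {G : Type*} [Group G] [TopologicalSpace G] [IsTopologicalGroup G]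
variable {X : Type*} [TopologicalSpace X] {α : Type*}

/-- Continuity of the conjugation family `(x, k) ↦ k⁻¹ * A x * k` at `(x₀, k)` from continuity of `A` at `x₀`. [cite: Bourbaki1995, Ch. III §1] -/
theorem continuousAt_conj_family {A : X → G} {x₀ : X} (hA : ContinuousAt A x₀) (k : G) :
    ContinuousAt (Function.uncurry fun (x : X) (k : G) => k⁻¹ * A x * k) (x₀, k) := by
  have h1 : ContinuousAt (fun p : X × G => A p.1) (x₀, k) := hA.comp_of_eq continuousAt_fst rfl
  have h2 : ContinuousAt (fun p : X × G => p.2) (x₀, k) := continuousAt_snd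
  exact (h2.inv.mul h1).mul h2

/-- **THE CONJUGATES FREEZE ON A COMPACT SET**: `φ` locally constant, `S ⊆ G` compact, `A : X → G` continuous AT `x₀`; then for `x` near `x₀`,
`φ (k⁻¹ * A x * k) = φ (k⁻¹ * A x₀ * k)` for ALL `k ∈ S` simultaneously. [cite: LabesseLanglands1979, §2 p. 9] [cite: Bourbaki1995, Ch. I §10.2 Th. 1 (tube lemma)] -/
theorem eventually_forall_apply_conj_eq_of_continuousAt {φ : G → α} (hφ : IsLocallyConstant φ) {S : Set G} (hS : IsCompact S)
    {A : X → G} {x₀ : X} (hA : ContinuousAt A x₀) :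
    ∀ᶠ x in 𝓝 x₀, ∀ k ∈ S, φ (k⁻¹ * A x * k) = φ (k⁻¹ * A x₀ * k) :=
  Literature.Topology.eventually_forall_apply_eq_of_isLocallyConstant (A := fun (x : X) (k : G) => k⁻¹ * A x * k) hφ hS
    fun k _ => continuousAt_conj_family hA k

/-- Shell-translated form: `φ (k⁻¹ * (r⁻¹ * A x * r) * k)` freezes on `S` near `x₀`. [cite: LabesseLanglands1979, §2 p. 9] -/
theorem eventually_forall_apply_conj_translate_eq_of_continuousAt {φ : G → α} (hφ : IsLocallyConstant φ) {S : Set G} (hS : IsCompact S)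
    (r : G) {A : X → G} {x₀ : X} (hA : ContinuousAt A x₀) :
    ∀ᶠ x in 𝓝 x₀, ∀ k ∈ S, φ (k⁻¹ * (r⁻¹ * A x * r) * k) = φ (k⁻¹ * (r⁻¹ * A x₀ * r) * k) :=
  eventually_forall_apply_conj_eq_of_continuousAt hφ hS (A := fun x => r⁻¹ * A x * r) ((continuousAt_const.mul hA).mul continuousAt_const)

end Pointwise

section Average

variable {G : Type*} [Group G] [TopologicalSpace G] [IsTopologicalGroup G] [MeasurableSpace G]
variable {X : Type*} [TopologicalSpace X]
variable {E : Type*} [NormedAddCommGroup E] [NormedSpace ℝ E]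

/-- **THE SHELL AVERAGE FREEZES**: `x ↦ ∫ k in S, φ (k⁻¹ * A x * k) ∂ν` is eventually equal to its value at `x₀` (`φ` locally constant, `S` compact measurable,
`A` continuous at `x₀`; ANY measure `ν`, no integrability needed). [cite: LabesseLanglands1979, §2 p. 9] [cite: Labesse2024StabilisationGermesSL2, Th. 0.0.12] -/
theorem eventually_setIntegral_conj_apply_eq_of_continuousAt (ν : Measure G) {φ : G → E} (hφ : IsLocallyConstant φ) {S : Set G} (hS : IsCompact S)
    (hSm : MeasurableSet S) {A : X → G} {x₀ : X} (hA : ContinuousAt A x₀) :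
    ∀ᶠ x in 𝓝 x₀, ∫ k in S, φ (k⁻¹ * A x * k) ∂ν = ∫ k in S, φ (k⁻¹ * A x₀ * k) ∂ν :=
  (eventually_forall_apply_conj_eq_of_continuousAt hφ hS hA).mono fun _ hx => setIntegral_congr_fun hSm fun k hk => hx k hk

/-- Shell-translated form of the freezing. [cite: LabesseLanglands1979, §2 p. 9] -/
theorem eventually_setIntegral_conj_translate_apply_eq_of_continuousAt (ν : Measure G) {φ : G → E} (hφ : IsLocallyConstant φ) {S : Set G}
    (hS : IsCompact S) (hSm : MeasurableSet S) (r : G) {A : X → G} {x₀ : X} (hA : ContinuousAt A x₀) :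
    ∀ᶠ x in 𝓝 x₀, ∫ k in S, φ (k⁻¹ * (r⁻¹ * A x * r) * k) ∂ν = ∫ k in S, φ (k⁻¹ * (r⁻¹ * A x₀ * r) * k) ∂ν :=
  (eventually_forall_apply_conj_translate_eq_of_continuousAt hφ hS r hA).mono fun _ hx => setIntegral_congr_fun hSm fun k hk => hx k hk

/-- **THE SHELL AVERAGE IS LOCALLY CONSTANT** along a continuous family: `IsLocallyConstant fun x => ∫ k in S, φ (k⁻¹ * A x * k) ∂ν`.
[cite: LabesseLanglands1979, §2 p. 9] [cite: Labesse2024StabilisationGermesSL2, Th. 0.0.12] -/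
theorem isLocallyConstant_setIntegral_conj_apply (ν : Measure G) {φ : G → E} (hφ : IsLocallyConstant φ) {S : Set G} (hS : IsCompact S)
    (hSm : MeasurableSet S) {A : X → G} (hA : Continuous A) :
    IsLocallyConstant fun x => ∫ k in S, φ (k⁻¹ * A x * k) ∂ν :=
  (IsLocallyConstant.iff_eventually_eq _).2 fun _ => eventually_setIntegral_conj_apply_eq_of_continuousAt ν hφ hS hSm hA.continuousAt

/-- Shell-translated form of the local constancy. [cite: LabesseLanglands1979, §2 p. 9] -/
theorem isLocallyConstant_setIntegral_conj_translate_apply (ν : Measure G) {φ : G → E} (hφ : IsLocallyConstant φ) {S : Set G} (hS : IsCompact S)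
    (hSm : MeasurableSet S) (r : G) {A : X → G} (hA : Continuous A) :
    IsLocallyConstant fun x => ∫ k in S, φ (k⁻¹ * (r⁻¹ * A x * r) * k) ∂ν :=
  (IsLocallyConstant.iff_eventually_eq _).2 fun _ => eventually_setIntegral_conj_translate_apply_eq_of_continuousAt ν hφ hS hSm r hA.continuousAt

end Average

section Window

variable {G : Type*} [Group G] [TopologicalSpace G] [IsTopologicalGroup G] [MeasurableSpace G]
variable {X : Type*} [TopologicalSpace X]
variable {E : Type*} [NormedAddCommGroup E] [NormedSpace ℝ E]
variable {ι : Type*} {M : Type*} [SMul M E]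

/-- **THE WINDOW SUM FREEZES** (families continuous at `x₀` only): for a finite window `I`, weights `a i`, shell representatives `r i`, and families `A i`, `B i`
continuous at `x₀`, the window sum `Σ_{i ∈ I} a_i • (f̄_{r_i}(A_i x) − f̄_{r_i}(B_i x))` is eventually equal to its value at `x₀`.
[cite: LabesseLanglands1979, §2 p. 9] [cite: Labesse2024StabilisationGermesSL2, Prop. 0.0.11, Th. 0.0.12] -/
theorem eventually_sum_smul_setIntegral_conj_sub_eq_of_continuousAt (ν : Measure G) {φ : G → E} (hφ : IsLocallyConstant φ) {S : Set G}
    (hS : IsCompact S) (hSm : MeasurableSet S) (I : Finset ι) (a : ι → M) (r : ι → G) {A B : ι → X → G} {x₀ : X}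
    (hA : ∀ i ∈ I, ContinuousAt (A i) x₀) (hB : ∀ i ∈ I, ContinuousAt (B i) x₀) :
    ∀ᶠ x in 𝓝 x₀,
      (∑ i ∈ I, a i • ((∫ k in S, φ (k⁻¹ * ((r i)⁻¹ * A i x * r i) * k) ∂ν) - ∫ k in S, φ (k⁻¹ * ((r i)⁻¹ * B i x * r i) * k) ∂ν)) =
        ∑ i ∈ I, a i • ((∫ k in S, φ (k⁻¹ * ((r i)⁻¹ * A i x₀ * r i) * k) ∂ν) - ∫ k in S, φ (k⁻¹ * ((r i)⁻¹ * B i x₀ * r i) * k) ∂ν) := by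
  have h : ∀ i ∈ I, ∀ᶠ x in 𝓝 x₀,
      a i • ((∫ k in S, φ (k⁻¹ * ((r i)⁻¹ * A i x * r i) * k) ∂ν) - ∫ k in S, φ (k⁻¹ * ((r i)⁻¹ * B i x * r i) * k) ∂ν) =
        a i • ((∫ k in S, φ (k⁻¹ * ((r i)⁻¹ * A i x₀ * r i) * k) ∂ν) - ∫ k in S, φ (k⁻¹ * ((r i)⁻¹ * B i x₀ * r i) * k) ∂ν) := fun i hi => by
    filter_upwards [eventually_setIntegral_conj_translate_apply_eq_of_continuousAt ν hφ hS hSm (r i) (hA i hi),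
      eventually_setIntegral_conj_translate_apply_eq_of_continuousAt ν hφ hS hSm (r i) (hB i hi)] with x hxA hxB
    rw [hxA, hxB]
  filter_upwards [(I.eventually_all).2 h] with x hx
  exact Finset.sum_congr rfl fun i hi => hx i hi

/-- **THE WINDOW SUM IS LOCALLY CONSTANT** (continuous families): `IsLocallyConstant fun x => Σ_{i ∈ I} a_i • (f̄_{r_i}(A_i x) − f̄_{r_i}(B_i x))`.
[cite: LabesseLanglands1979, §2 p. 9] [cite: Labesse2024StabilisationGermesSL2, Prop. 0.0.11, Th. 0.0.12] -/
theorem isLocallyConstant_sum_smul_setIntegral_conj_sub (ν : Measure G) {φ : G → E} (hφ : IsLocallyConstant φ) {S : Set G} (hS : IsCompact S)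
    (hSm : MeasurableSet S) (I : Finset ι) (a : ι → M) (r : ι → G) {A B : ι → X → G}
    (hA : ∀ i ∈ I, Continuous (A i)) (hB : ∀ i ∈ I, Continuous (B i)) :
    IsLocallyConstant fun x =>
      ∑ i ∈ I, a i • ((∫ k in S, φ (k⁻¹ * ((r i)⁻¹ * A i x * r i) * k) ∂ν) - ∫ k in S, φ (k⁻¹ * ((r i)⁻¹ * B i x * r i) * k) ∂ν) :=
  (IsLocallyConstant.iff_eventually_eq _).2 fun _ =>
    eventually_sum_smul_setIntegral_conj_sub_eq_of_continuousAt ν hφ hS hSm I a r (fun i hi => (hA i hi).continuousAt) fun i hi => (hB i hi).continuousAt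

/-- Single-family window `Σ_{i ∈ I} a_i • f̄_{r_i}(A_i x)` is locally constant. [cite: LabesseLanglands1979, §2 p. 9] -/
theorem isLocallyConstant_sum_smul_setIntegral_conj (ν : Measure G) {φ : G → E} (hφ : IsLocallyConstant φ) {S : Set G} (hS : IsCompact S)
    (hSm : MeasurableSet S) (I : Finset ι) (a : ι → M) (r : ι → G) {A : ι → X → G} (hA : ∀ i ∈ I, Continuous (A i)) :
    IsLocallyConstant fun x => ∑ i ∈ I, a i • ∫ k in S, φ (k⁻¹ * ((r i)⁻¹ * A i x * r i) * k) ∂ν :=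
  Literature.Topology.isLocallyConstant_finset_sum_fun I fun i hi =>
    (IsLocallyConstant.const (a i)).comp₂ (isLocallyConstant_setIntegral_conj_translate_apply ν hφ hS hSm (r i) (hA i hi)) (· • ·)

/-- **THE FOLD'S `hW` BINDER** for a window sum of shell averages along continuous families: at every `s` with `P s` (e.g. `s` singular) and any guard `U`,
`∀ᶠ t in 𝓝 s, t ∈ U → W t = W s` — the (Ψ3) hypothesis of `rankOneUnstable_core_of_shellWindow` by `exact`. [cite: LabesseLanglands1979, §2 p. 9] -/
theorem forall_imp_eventually_mem_imp_sum_smul_setIntegral_conj_sub_eq (ν : Measure G) {φ : G → E} (hφ : IsLocallyConstant φ) {S : Set G}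
    (hS : IsCompact S) (hSm : MeasurableSet S) (I : Finset ι) (a : ι → M) (r : ι → G) {A B : ι → X → G}
    (hA : ∀ i ∈ I, Continuous (A i)) (hB : ∀ i ∈ I, Continuous (B i)) (P : X → Prop) (U : Set X) :
    ∀ s, P s → ∀ᶠ t in 𝓝 s, t ∈ U →
      (∑ i ∈ I, a i • ((∫ k in S, φ (k⁻¹ * ((r i)⁻¹ * A i t * r i) * k) ∂ν) - ∫ k in S, φ (k⁻¹ * ((r i)⁻¹ * B i t * r i) * k) ∂ν)) =
        ∑ i ∈ I, a i • ((∫ k in S, φ (k⁻¹ * ((r i)⁻¹ * A i s * r i) * k) ∂ν) - ∫ k in S, φ (k⁻¹ * ((r i)⁻¹ * B i s * r i) * k) ∂ν) :=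
  Literature.Topology.forall_imp_eventually_mem_imp_eq_of_isLocallyConstant (isLocallyConstant_sum_smul_setIntegral_conj_sub ν hφ hS hSm I a r hA hB) P U

/-- `ContinuousAt` version of the binder: the families need only be continuous AT the point `s` (normalised window coordinates are typically defined near the
singular points only). [cite: LabesseLanglands1979, §2 p. 9] -/
theorem eventually_mem_imp_sum_smul_setIntegral_conj_sub_eq_of_continuousAt (ν : Measure G) {φ : G → E} (hφ : IsLocallyConstant φ) {S : Set G}
    (hS : IsCompact S) (hSm : MeasurableSet S) (I : Finset ι) (a : ι → M) (r : ι → G) {A B : ι → X → G} {s : X}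
    (hA : ∀ i ∈ I, ContinuousAt (A i) s) (hB : ∀ i ∈ I, ContinuousAt (B i) s) (U : Set X) :
    ∀ᶠ t in 𝓝 s, t ∈ U →
      (∑ i ∈ I, a i • ((∫ k in S, φ (k⁻¹ * ((r i)⁻¹ * A i t * r i) * k) ∂ν) - ∫ k in S, φ (k⁻¹ * ((r i)⁻¹ * B i t * r i) * k) ∂ν)) =
        ∑ i ∈ I, a i • ((∫ k in S, φ (k⁻¹ * ((r i)⁻¹ * A i s * r i) * k) ∂ν) - ∫ k in S, φ (k⁻¹ * ((r i)⁻¹ * B i s * r i) * k) ∂ν) :=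
  (eventually_sum_smul_setIntegral_conj_sub_eq_of_continuousAt ν hφ hS hSm I a r hA hB).mono fun _ h _ => h

end Window

end Literature.NumberTheory.Automorphic
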